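import Mathlib.MeasureTheory.Integral.Pi
import Literature.Probability.Divergences.KLDivSuperadditive
import HarnessLib

/-!
# Superadditivity of the Kullback–Leibler divergence with respect to a FINITE PRODUCT reference
# (Polyanskiy–Wu Thm 2.16(c), `n` factors)

Topic `Literature/Probability/Divergences`; the `n`-fold form announced as `TODO(general form)` in
`KLDivSuperadditive.lean` (binary case).  PROVED (no named facts, no definitions), for Mathlib's `InformationTheory.klDiv`,
`Measure.pi` and the coordinate marginals `P.map (Function.eval i)` of a probability law on a finite product `Π i, X i`:

* `toReal_sum_klDiv_map_eval_le` — for probability measures `P` on `Π i, X i` and `Q i` on `X i` with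
  `KL(P ‖ ⨂ᵢ Q i) < ∞`: every marginal divergence is finite and
  `∑ᵢ KL(P_i ‖ Q i) ≤ KL(P ‖ ⨂ᵢ Q i)` [cite: PolyanskiyWu2024, Thm 2.16(c) eq. (2.27)];
* `sum_klDiv_map_eval_le` — the same in `ℝ≥0∞` (trivial when the right side is infinite).

Proof by DUALITY, as in the binary file (no standard-Borel hypothesis, no disintegration): the Donsker–Varadhan functional of
the test function `x ↦ ∑ᵢ gᵢ(xᵢ)` factorises over the product reference (`integral_fintype_prod_eq_prod`), giving
`∑ᵢ [E_{P_i} gᵢ − log E_{Q_i} e^{gᵢ}] ≤ KL(P ‖ ⨂ Q)` (`dv_pi_sum_le`); the hard half of Donsker–Varadhan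
(`klDiv_le_of_forall_integral_le`) then converts the suprema into marginal divergences one coordinate at a time (an induction on
the set of coordinates already converted).

Why here: the localisation step («an extensive entropy budget against a product reference is a sum of block budgets», Csiszár)
of the relative-entropy method — used by the Yang–Mills entropy-budget line (`Summits/…/EntropyBudgetEquipartition*`, crux
stmt-QuantumFields-22401: a torus budget against a block-product Gaussian reference is the sum of the block budgets) and by
hydrodynamic-limit arguments.
-/

noncomputable section

namespace Literature.Probability.Divergences

open _root_.MeasureTheory Filter InformationTheory

variable {ι : Type*} [Fintype ι] [DecidableEq ι] {X : ι → Type*} [∀ i, MeasurableSpace (X i)]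

/-- From a Donsker–Varadhan bound with budget `K` to the real inequality `KL.toReal ≤ K` (and finiteness); local copy of the
binary file's helper. [folklore] -/
private theorem toReal_klDiv_le_of_forall' {α : Type*} [MeasurableSpace α] {μ ν : Measure α}
    [IsProbabilityMeasure μ] [IsProbabilityMeasure ν] {K : ℝ}
    (h : ∀ (ψ : α → ℝ) (C : ℝ), Measurable ψ → (∀ x, |ψ x| ≤ C) →
      ∫ x, ψ x ∂μ ≤ K + Real.log (∫ x, Real.exp (ψ x) ∂ν)) :
    klDiv μ ν ≠ ⊤ ∧ (klDiv μ ν).toReal ≤ K := by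
  have hK : 0 ≤ K := by
    have := h (fun _ => 0) 0 measurable_const (fun _ => by simp)
    simp only [integral_const, smul_eq_mul, mul_zero, Real.exp_zero, probReal_univ, mul_one, Real.log_one,
      add_zero] at this
    exact this
  have hle := klDiv_le_of_forall_integral_le h
  refine ⟨ne_top_of_le_ne_top ENNReal.ofReal_ne_top hle, ?_⟩
  exact (ENNReal.toReal_mono ENNReal.ofReal_ne_top hle).trans (by rw [ENNReal.toReal_ofReal hK])

omit [DecidableEq ι] in
/-- The Donsker–Varadhan functional of a separable test function `x ↦ ∑ᵢ gᵢ(xᵢ)` splits over the coordinate marginals and a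
product reference: for bounded measurable `gᵢ` and probability measures `P` on `Π i, X i`, `Q i` on `X i` with
`KL(P ‖ ⨂ Q) < ∞`, `∑ᵢ [∫ gᵢ dP_i − log ∫ e^{gᵢ} dQ_i] ≤ KL(P ‖ ⨂ Q)`. [folklore] -/
private theorem dv_pi_sum_le {P : Measure (Π i, X i)} [IsProbabilityMeasure P] {Q : Π i, Measure (X i)}
    [∀ i, IsProbabilityMeasure (Q i)] (hfin : klDiv P (Measure.pi Q) ≠ ⊤)
    {g : Π i, X i → ℝ} {C : ι → ℝ} (hg : ∀ i, Measurable (g i)) (hC : ∀ i x, |g i x| ≤ C i) :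
    ∑ i, ((∫ x, g i x ∂P.map (Function.eval i)) - Real.log (∫ x, Real.exp (g i x) ∂Q i)) ≤
      (klDiv P (Measure.pi Q)).toReal := by
  -- the bounded measurable test function `ψ(x) = ∑ i, g i (x i)`
  have hψ : Measurable fun x : Π i, X i => ∑ i, g i (x i) :=
    Finset.measurable_sum _ fun i _ => (hg i).comp (measurable_pi_apply i)
  have hψC : ∀ x : Π i, X i, |∑ i, g i (x i)| ≤ ∑ i, C i := fun x =>
    (Finset.abs_sum_le_sum_abs _ _).trans (Finset.sum_le_sum fun i _ => hC i (x i))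
  have dv := integral_le_toReal_klDiv_add_log (μ := P) (ν := Measure.pi Q) hfin hψ hψC
  -- `∫ ψ dP = ∑ i, ∫ g i dP_i`
  have hi : ∀ i, Integrable (fun x : Π i, X i => g i (x i)) P := fun i =>
    Integrable.of_bound ((hg i).comp (measurable_pi_apply i)).aestronglyMeasurable (C i)
      (ae_of_all _ fun x => by rw [Real.norm_eq_abs]; exact hC i (x i))
  have hsum : (∫ x, ∑ i, g i (x i) ∂P) = ∑ i, ∫ x, g i x ∂P.map (Function.eval i) := by
    rw [integral_finsetSum _ fun i _ => hi i]
    refine Finset.sum_congr rfl fun i _ => ?_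
    rw [integral_map (measurable_pi_apply i).aemeasurable (hg i).aestronglyMeasurable]
  -- `∫ e^ψ d(⨂ Q) = ∏ i, ∫ e^{g i} dQ_i`
  have hprod : (∫ x, Real.exp (∑ i, g i (x i)) ∂Measure.pi Q) = ∏ i, ∫ x, Real.exp (g i x) ∂Q i := by
    simp_rw [Real.exp_sum]
    exact integral_fintype_prod_eq_prod (fun i (x : X i) => Real.exp (g i x))
  have hpos : ∀ i, 0 < ∫ x, Real.exp (g i x) ∂Q i := fun i =>
    integral_exp_pos (Integrable.of_bound (hg i).exp.aestronglyMeasurable (Real.exp (C i))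
      (ae_of_all _ fun x => by
        rw [Real.norm_eq_abs, abs_of_pos (Real.exp_pos _), Real.exp_le_exp]
        exact (le_abs_self _).trans (hC i x)))
  rw [hsum, hprod, Real.log_prod (s := Finset.univ) (fun i _ => (hpos i).ne')] at dv
  rw [Finset.sum_sub_distrib]
  linarith

/-- **Superadditivity of relative entropy for a finite product reference** (Polyanskiy–Wu (2.27), `n` factors): for probability
measures `P` on `Π i, X i` and `Q i` on `X i` with `KL(P ‖ ⨂ᵢ Q i) < ∞`, every coordinate marginal `P_i = P ∘ evalᵢ⁻¹` has
finite divergence from `Q i` and `∑ᵢ KL(P_i ‖ Q i) ≤ KL(P ‖ ⨂ᵢ Q i)`.  Proved by duality (no standard-Borel hypothesis).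
[cite: PolyanskiyWu2024, Thm 2.16(c) eq. (2.27)] -/
theorem toReal_sum_klDiv_map_eval_le {P : Measure (Π i, X i)} [IsProbabilityMeasure P] {Q : Π i, Measure (X i)}
    [∀ i, IsProbabilityMeasure (Q i)] (hfin : klDiv P (Measure.pi Q) ≠ ⊤) :
    (∀ i, klDiv (P.map (Function.eval i)) (Q i) ≠ ⊤) ∧
      ∑ i, (klDiv (P.map (Function.eval i)) (Q i)).toReal ≤ (klDiv P (Measure.pi Q)).toReal := by
  haveI : ∀ i, IsProbabilityMeasure (P.map (Function.eval i)) := fun i =>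
    Measure.isProbabilityMeasure_map (measurable_pi_apply i).aemeasurable
  set K : ℝ := (klDiv P (Measure.pi Q)).toReal with hK
  -- the Donsker–Varadhan functional of one coordinate
  set D : Π i, (X i → ℝ) → ℝ :=
    fun i f => (∫ x, f x ∂P.map (Function.eval i)) - Real.log (∫ x, Real.exp (f x) ∂Q i) with hD
  -- induction on the set `S` of coordinates already converted into divergences
  have claim : ∀ S : Finset ι, ∀ (g : Π i, X i → ℝ) (C : ι → ℝ), (∀ i, Measurable (g i)) → (∀ i x, |g i x| ≤ C i) →
      (∀ i ∈ S, klDiv (P.map (Function.eval i)) (Q i) ≠ ⊤) ∧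
        ∑ i ∈ S, (klDiv (P.map (Function.eval i)) (Q i)).toReal + ∑ i ∈ Sᶜ, D i (g i) ≤ K := by
    intro S
    induction S using Finset.induction_on with
    | empty =>
      intro g C hg hC
      refine ⟨fun i hi => absurd hi (Finset.notMem_empty i), ?_⟩
      rw [Finset.sum_empty, zero_add, Finset.compl_empty]
      exact dv_pi_sum_le hfin hg hC
    | @insert j S hj ih =>
      intro g C hg hC
      -- the budget left for coordinate `j`
      set R : ℝ := ∑ i ∈ S, (klDiv (P.map (Function.eval i)) (Q i)).toReal + ∑ i ∈ (insert j S)ᶜ, D i (g i) with hR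
      have hj' : klDiv (P.map (Function.eval j)) (Q j) ≠ ⊤ ∧ (klDiv (P.map (Function.eval j)) (Q j)).toReal ≤ K - R := by
        refine toReal_klDiv_le_of_forall' fun ψ C₀ hψ hC₀ => ?_
        -- test the family with the `j`-th function replaced by `ψ`
        set g' : Π i, X i → ℝ := Function.update g j ψ with hg'
        have hg'm : ∀ i, Measurable (g' i) := by
          intro i
          by_cases h : i = j
          · subst h; rw [hg', Function.update_self]; exact hψ
          · rw [hg', Function.update_of_ne h]; exact hg i
        have hC' : ∀ i x, |g' i x| ≤ Function.update C j C₀ i := by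
          intro i x
          by_cases h : i = j
          · subst h; rw [hg', Function.update_self, Function.update_self]; exact hC₀ x
          · rw [hg', Function.update_of_ne h, Function.update_of_ne h]; exact hC i x
        obtain ⟨-, hle⟩ := ih g' (Function.update C j C₀) hg'm hC'
        -- `Sᶜ = {j} ∪ (insert j S)ᶜ`
        have hsplit : ∑ i ∈ Sᶜ, D i (g' i) = D j ψ + ∑ i ∈ (insert j S)ᶜ, D i (g i) := by
          have hSc : Sᶜ = insert j (insert j S)ᶜ := by
            ext i
            simp only [Finset.mem_compl, Finset.mem_insert]
            constructor
            · intro hi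
              by_cases h : i = j
              · exact Or.inl h
              · exact Or.inr (not_or.2 ⟨h, hi⟩)
            · rintro (h | h)
              · rw [h]; exact hj
              · exact fun hi => h (Or.inr hi)
          have hjc : j ∉ (insert j S)ᶜ := by simp
          rw [hSc, Finset.sum_insert hjc]
          congr 1
          · rw [hg', Function.update_self]
          · refine Finset.sum_congr rfl fun i hi => ?_
            have hij : i ≠ j := by
              intro h; rw [h] at hi; exact hjc hi
            rw [hg', Function.update_of_ne hij]
        rw [hsplit] at hle
        have hDj : D j ψ = (∫ x, ψ x ∂P.map (Function.eval j)) - Real.log (∫ x, Real.exp (ψ x) ∂Q j) := rfl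
        rw [hR]
        linarith
      refine ⟨fun i hi => ?_, ?_⟩
      · rcases Finset.mem_insert.1 hi with rfl | hi
        · exact hj'.1
        · exact (ih g C hg hC).1 i hi
      · rw [Finset.sum_insert hj]
        have := hj'.2
        rw [hR] at this
        linarith
  have h := claim Finset.univ (fun i _ => (0 : ℝ)) (fun _ => 0) (fun _ => measurable_const) (fun _ _ => by simp)
  rw [Finset.compl_univ, Finset.sum_empty, add_zero] at h
  exact ⟨fun i => h.1 i (Finset.mem_univ i), h.2⟩

/-- **Superadditivity for a finite product reference, `ℝ≥0∞` form**: `∑ᵢ KL(P_i ‖ Q i) ≤ KL(P ‖ ⨂ᵢ Q i)` for probability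
measures (trivial when the right side is infinite). [cite: PolyanskiyWu2024, Thm 2.16(c) eq. (2.27)] -/
theorem sum_klDiv_map_eval_le {P : Measure (Π i, X i)} [IsProbabilityMeasure P] {Q : Π i, Measure (X i)}
    [∀ i, IsProbabilityMeasure (Q i)] :
    ∑ i, klDiv (P.map (Function.eval i)) (Q i) ≤ klDiv P (Measure.pi Q) := by
  by_cases hfin : klDiv P (Measure.pi Q) = ⊤
  · rw [hfin]; exact le_top
  obtain ⟨hfi, hle⟩ := toReal_sum_klDiv_map_eval_le hfin
  have hsum : (∑ i, klDiv (P.map (Function.eval i)) (Q i)) ≠ ⊤ :=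
    ENNReal.sum_ne_top.2 fun i _ => hfi i
  rw [← ENNReal.toReal_le_toReal hsum hfin, ENNReal.toReal_sum fun i _ => hfi i]
  exact hle

end Literature.Probability.Divergences

end
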